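import Mathlib
import Literature.MathematicalPhysics.QuantumFieldTheory.MagnenRivasseauSeneor1993.MRS93StartingAnsatz
import Literature.MathematicalPhysics.QuantumFieldTheory.MagnenRivasseauSeneor1993.MRS93MainStatement
import HarnessLib

/-!
# Magnen–Rivasseau–Sénéor (CMP 155, 1993), the main statement p.327 — PINNED CARRIER: the printed kinematic data
# (momentum lattice `ℤ⁴ ∖ {0}` of the torus, Lorentz/colour indices, axial gauge `A₀ = 0`, normalized expectations
# `⟨·⟩_{ax,ρ}` as probability laws, the Slavnov left-hand side as a finitary functional of Schwinger functions) and
# the printed parameters ((II.11), (II.13)–(II.14), ζ, ε₁, ε₂, N, ρ ≪ ρ₂ ≪ ρ₁) as NAMED BINDERS; the vacuity frontier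
# stated and proved

statement-level skeleton of a published CLAIM with citation tags; bookkeeping proved; nothing here is a claim about
the Yang–Mills mass gap, about continuum Yang–Mills on `T⁴` without infrared cutoff, or about the Clay problem — and
nothing of Magnen–Rivasseau–Sénéor's analysis is asserted or formalised

**Citation header (reproduction of PUBLISHED work).** J. Magnen, V. Rivasseau, R. Sénéor, *Construction of YM₄ with
an infrared cutoff*, Commun. Math. Phys. **155** (1993) 325–383 [MagnenRivasseauSeneor1993]. Loci `p.NNN tl.nn` =
journal page / text-layer line of the held scan `paper:magnen1993-cmp155-mrs-ym4-infrared-cutoff` (PDF page =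
journal page − 324), displays read on the page images (renders of record
`run/shared/lean/pub/lit-balaban/inprint/lit-balaban-p14/renders-cmp155/`). Cell pub-balaban-gaps, track G3, seat
mrs-lit-1; this module answers the cell referee's verdict REF-G3-v1 (2026-08-22, `HOME/referee/VERDICTS.md` §G3 v1,
probe `HOME/referee/probe-MRSMainVacuity.lean`): `…MRS93MainStatement.MainStatementPrinted` is a predicate over a
FREE carrier `AxialTheory`; here the carrier is PINNED to what the print fixes, the main statement is restated over
the pinned carrier (`PinnedTheory.PrintedStatement` — definitionally `MainStatementPrinted` of the underlying carrier),
and what remains unpinned is said and PROVED (`diracModel_mainStatement`), not hidden.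

**What the print fixes, and how it is pinned here.**
* (K1) *«the torus Λ = ℝ⁴/ℤ⁴ … The momentum space corresponds to discrete Fourier analysis on the dual lattice
  Λ* = ℤ⁴. Moreover the constant fields or the zero mode in Fourier space is deleted in all our functional
  integrals»* (p.328 tl.7–15); *«a field A with components A^a_μ, μ = 0,1,2,3, a = 1,2,3»* (p.328 tl.16–17) ⟶
  `Momentum = {p : ℤ⁴ // p ≠ 0}`, `Mode = Momentum × Fin 4 × Fin 3 × Bool` (the `Bool` selects the real or the
  imaginary part of the Fourier coefficient `Ã^a_μ(p)`, so that configurations are REAL coordinates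
  `Config = Mode → ℝ`); test data of an `N`-point function = `Fin N → Mode` (no smearing needed on the lattice of
  momenta: the Schwinger functions are the joint moments of the Fourier modes).
* (K2) *«A₀ = 0. (II.7)»* (p.329 tl.21); *«Our initial axial field A has only nine scalar components since A₀ was
  identically 0»* (p.342 tl.3–4); the Schwinger functions are those of the axial field: *«W(J) = ⟨e^{−F²/4+J·A}
  δ(A₀)⟩ = ⟨e^{J·A}⟩_ax, (VIII.1)»* (p.377 tl.17), *«Our bare ansatz is written for a theory with field A
  satisfying an axial gauge condition»* (p.377 tl.3–4) ⟶ field `axial`: every moment containing a time component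
  vanishes.
* (K3) *«⟨·⟩_{ax,ρ}, the normalized functional integral of our theory with cutoff»* (p.378 tl.17), *«normalized
  Schwinger functions with cutoff ρ»* (tl.21) ⟶ for each `ρ` a PROBABILITY LAW `law ρ` on `Config` with all
  moments finite, and `S ρ N f = ∫ Π_j A(f j) d(law ρ)` (`PinnedTheory.schwinger`). Consequences PROVED, which no
  free carrier has: `schwinger_empty` (`⟨1⟩ = 1`), `schwinger_perm` (symmetry), `schwinger_sq_nonneg`.
* (K4) the left-hand side of (VIII.6) is *«made of normalized Schwinger functions»* (p.378 tl.20–21): the display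
  `⟨Σ_i (Π_{j≠i} A^{a_j}_{m_j}(x_j)) D^{a_i b}_{m_i} δ(x_i − y) − Π_j A^{a_j}_{m_j}(x_j)[∂/∂yⁿ A^b_n(y)](∂/∂y⁰)²⟩_ax`
  with `D = ∂ − λ[A, ·]` is, for fixed test data, a finite linear combination (coefficients: momenta, `λ`, `δ^{ab}`,
  `ε_abc`) of values of the `(N−2)`-, `(N−1)`- and `N`-point functions ⟶ field `wardData N x = (c₀, [(c_k, n_k,
  f_k)]_k)` and `wardLHS G N x = c₀ + Σ_k c_k · G n_k f_k` (`finitaryWard`). Consequence PROVED: the printed «by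
  definition tends to» (p.378 tl.20–22) is now a LEMMA — `PinnedTheory.wardLimit` derives `WardLimitPrinted` from
  `UVLimitExistsPrinted`, so the Sect. VIII reduction needs one hypothesis less (`PinnedTheory.mainStatement_of_
  sectVIII`). The Fourier-space coefficients themselves are NOT fixed here (the print fixes no Fourier conventions
  and does not say which coupling — bare `λ_ρ` or renormalized — multiplies `[A, ·]` in (VIII.6)); only the SHAPE
  «finite linear combination of Schwinger values» is imposed.
* (K5) the printed parameters as NAMED BINDERS (`Parameters`): the profile `τ` and plateau constant `η > 0` of the
  cutoff (II.14) and the scale ratio `M` (*«It is convenient to take M an integer»*, p.335 tl.18; `M ≥ 2` so that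
  `M^ρ → ∞`), with `uvCutoff ρ = Ansatz.scaledCutoff τ η M ρ` (II.13); `β₂ ≠ 0, β₃, C` of (II.11) with
  `bareCoupling ρ = Ansatz.bareCouplingSq β₂ β₃ M C ρ`; the homothetic gauge parameter `ζ` (*«close to 3/13»*
  p.332 tl.40, region *«0 ≤ ζ ≤ 1»* of Lemma VI.2 p.374 tl.2); the exponents *«1 ≫ ε₂ > ε₁»* (p.339 tl.21; *«ε₁
  and ε₂ are very small»* p.329 tl.14) read as `0 < ε₁ < ε₂ < 1`; the integer `N` of (II.37)/(II.78) (*«N is some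
  large integer»* p.339 tl.34, *«we can fix e.g. N = 100»* p.347 tl.7); the auxiliary cutoffs *«ρ ≪ ρ₂ ≪ ρ₁»*
  (p.340 tl.15, p.339 tl.24) read as `ρ < ρ₂(ρ) < ρ₁(ρ)`. READINGS flagged: «≪», «very small», «large» are typed
  as the bare inequalities they at least imply; thresholds are the business of `MainStatementEventually`.

**The vacuity frontier (honest, PROVED).** `uvCutoff`, `bareCoupling`, `ζ`, `ε₁`, `ε₂`, `N`, `ρ₁`, `ρ₂` are NAMED
but cannot CONSTRAIN `law ρ` inside Lean short of constructing the bare measure (II.78) itself — eleven factors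
(p.347 tl.2–7) including `χ_LFR`, `G(A′,γ)` (II.45), `K_{ρ,ρ₂}` (II.76), `CT_ρ` (III.1), `L_{0,ρ₁}F` (II.46)–(II.47),
whose very normalizability is part of the authors' sketch («This formula is still formal», p.332 tl.21; Lemma II.1
«Sketch of proof»), and which is NOT DEFINITION-COMPLETE IN PRINT: the counterterm coefficients of (III.1) are given
only asymptotically («a_ρ ≅ aλ_ρ⁴, b_ρ ≅ bM^{2ρ}λ_ρ², c_ρ ≅ cλ_ρ², d_ρ ≅ dλ_ρ², e_ρ ≅ eλ_ρ⁴» (III.2) p.348) and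
`b_ρ` implicitly — *«The relevant counterterm b_ρ∫(A²/2) must be fine tuned exactly to have a renormalized mass
which is zero. This is the same problem as fixing the critical bare mass in infrared φ⁴₄ [FMRS1], [R] and should
be solved by a fixed point argument as in [R]»* (p.347 tl.36–40) —, `N` and `N′` are «some large integer» ((II.37)
p.339 tl.34, (II.47) p.342 tl.15), the LFR sum runs over the outcome of two expansions (II.25)/(II.29a). So no
Lean `Measure` can be written for (II.78) «as printed»; the strongest faithful typing is an interface with named
binders, which is what this file provides (`PinnedTheory`, `AxialTheory.IsMRSTheory`). Likewise `E_N` of (VIII.6) *«can be computed for any given infrared cutoff»* (p.378 tl.9) but no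
formula is printed. Consequently the pinned statement still has a degenerate model, and we exhibit it rather than
leave it to a probe: `diracModel` (every `law ρ` = the Dirac mass at the zero configuration, `E :=` the constant
term of the Ward functional) satisfies `PinnedTheory.PrintedStatement` (`diracModel_mainStatement`). What it KILLS:
the referee's all-zero carrier (`⟨1⟩ = 1` fails there: `not_schwinger_all_zero`) and every carrier whose `S` is
not a moment family or whose Ward side is not finitary. What would remove the Dirac model: any printed closed-form
normalisation of a Schwinger function of (II.78) (e.g. the free covariance at `λ = 0`) — the paper prints none
(the measure is interacting at every cutoff), so none is typed. This is the exact sense in which MRS's main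
statement is available «as an explicit hypothesis with named binders» and not more.

**What is NOT claimed.** As in `…MRS93MainStatement`; in addition: that (II.78) defines a probability law (it is
ASSUMED in `PinnedTheory`, being part of the printed sketch), and any Fourier-space form of (VIII.6).
-/

noncomputable section

open Filter Topology MeasureTheory

namespace Literature.MathematicalPhysics.QuantumFieldTheory.MagnenRivasseauSeneor1993

namespace MainStatement

open Ansatz

/-! ## (K1)–(K2) Kinematics: momentum lattice, indices, configurations -/

/-- Momenta: the dual lattice `Λ* = ℤ⁴` of the torus `ℝ⁴/ℤ⁴` with the zero mode deleted (p.328 tl.12–15).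
[cite: MagnenRivasseauSeneor1993, §II.A p.328] -/
abbrev Momentum : Type := {p : Fin 4 → ℤ // p ≠ 0}

/-- A real coordinate of the field: momentum `p`, Lorentz index `μ ∈ {0,1,2,3}` («μ = 0, called the time», p.328
tl.19), colour index `a ∈ {1,2,3}` (here `Fin 3`), and a flag selecting `Re Ã^a_μ(p)` (`false`) or `Im Ã^a_μ(p)`
(`true`). [cite: MagnenRivasseauSeneor1993, §II.A p.328] -/
abbrev Mode : Type := Momentum × Fin 4 × Fin 3 × Bool

/-- Time components: Lorentz index `μ = 0`. [cite: MagnenRivasseauSeneor1993, §II.A p.328 tl.19] -/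
def Mode.IsTime (m : Mode) : Prop := m.2.1 = 0

/-- Field configurations in these coordinates. [cite: MagnenRivasseauSeneor1993, §II.A p.328] -/
abbrev Config : Type := Mode → ℝ

/-- The monomial `A ↦ Π_j A(f j)` whose expectation is the `N`-point Schwinger function at test datum `f`.
[cite: MagnenRivasseauSeneor1993, (VIII.1) p.377] -/
def monomial {N : ℕ} (f : Fin N → Mode) (A : Config) : ℝ := ∏ j, A (f j)

/-- Monomials are measurable (finite products of coordinate evaluations). [cite: MagnenRivasseauSeneor1993, (VIII.1) p.377] -/
theorem measurable_monomial {N : ℕ} (f : Fin N → Mode) : Measurable (monomial f) := by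
  unfold monomial
  exact Finset.measurable_prod _ fun j _ => measurable_pi_apply (f j)

/-! ## (K5) The printed parameters as named binders -/

/-- The printed parameters of the ansatz, with the inequalities the print states or at least implies (module
docstring (K5); «≪», «small», «large» read as bare inequalities — flagged). [cite: MagnenRivasseauSeneor1993, (II.11) p.330, (II.13)–(II.14) p.331, p.329 tl.14, p.339 tl.21–34, p.340 tl.15, p.374 tl.2] -/
structure Parameters where
  /-- the reference profile `τ` of the cutoff class (p.330 tl.31–34) -/
  τ : CutoffProfile
  /-- the plateau constant `η` of (II.14), «a small constant» -/
  η : ℝ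
  hη : 0 < η
  /-- the scale ratio `M` («It is convenient to take M an integer», p.335 tl.18) -/
  M : ℕ
  hM : 2 ≤ M
  /-- (II.11): «β₂ and β₃ are the usual first non-vanishing coefficients of the β function» -/
  β₂ : ℝ
  β₃ : ℝ
  hβ₂ : β₂ ≠ 0
  /-- (II.11): «C is a large constant» -/
  C : ℝ
  /-- the homothetic gauge parameter, «close to 3/13» (p.332 tl.40), in the region «0 ≤ ζ ≤ 1» (p.374 tl.2) -/
  ζ : ℝ
  hζ : 0 ≤ ζ ∧ ζ ≤ 1
  /-- «ε₁ and ε₂ are very small» (p.329 tl.14), «1 ≫ ε₂ > ε₁» (p.339 tl.21) -/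
  ε₁ : ℝ
  ε₂ : ℝ
  hε : 0 < ε₁ ∧ ε₁ < ε₂ ∧ ε₂ < 1
  /-- the integer `N` of (II.37)/(II.78): «N is some large integer», «we can fix e.g. N = 100» -/
  Nexp : ℕ
  /-- auxiliary cutoffs `ρ₂(ρ)`, `ρ₁(ρ)` with «ρ ≪ ρ₂ ≪ ρ₁» (p.340 tl.15) -/
  ρ₂ : ℕ → ℕ
  ρ₁ : ℕ → ℕ
  hρ : ∀ ρ, ρ < ρ₂ ρ ∧ ρ₂ ρ < ρ₁ ρ

namespace Parameters

variable (par : Parameters)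

/-- The ultraviolet cutoff at index `ρ`, (II.13)–(II.14): `κ_ρ(|p|)` built from the named `τ, η, M`.
[cite: MagnenRivasseauSeneor1993, (II.13)–(II.14) p.331] -/
def uvCutoff (ρ : ℕ) (r : ℝ) : ℝ := scaledCutoff par.τ par.η par.M ρ r

/-- The bare coupling `λ_ρ²` of (II.11) built from the named `β₂, β₃, M, C`.
[cite: MagnenRivasseauSeneor1993, (II.11) p.330] -/
def bareCoupling (ρ : ℕ) : ℝ := bareCouplingSq par.β₂ par.β₃ par.M par.C ρ

/-- The tentative effective couplings (II.12). [cite: MagnenRivasseauSeneor1993, (II.12) p.330] -/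
def tentativeCoupling (i : ℕ) : ℝ := tentativeCouplingSq par.β₂ par.β₃ par.M par.C i

/-- `M > 1` as a real number (so `M^ρ → ∞`: the ultraviolet limit is `ρ → ∞`, p.330 tl.14–15).
[cite: MagnenRivasseauSeneor1993, p.330 tl.14–15] -/
theorem one_lt_M : (1 : ℝ) < par.M := by
  have := par.hM
  exact_mod_cast this

/-- With the printed sign of asymptotic freedom (`β₂ < 0`) the named bare coupling tends to `0`
(`Ansatz.tendsto_bareCouplingSq_zero`). [cite: MagnenRivasseauSeneor1993, (II.11) p.330] -/
theorem tendsto_bareCoupling_zero (hβ₂ : par.β₂ < 0) :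
    Tendsto (fun ρ : ℕ => par.bareCoupling ρ) atTop (𝓝 0) :=
  (tendsto_bareCouplingSq_zero par.β₃ par.C hβ₂ par.one_lt_M).comp tendsto_natCast_atTop_atTop

/-- The named cutoff is `1` below scale `M^ρ` and `0` beyond `(3 + η⁻¹)M^ρ` (from `…MRS93StartingAnsatz`).
[cite: MagnenRivasseauSeneor1993, (II.13)–(II.14) p.331] -/
theorem uvCutoff_eq_one_and_zero (ρ : ℕ) {r : ℝ} :
    (r ≤ (par.M : ℝ) ^ ρ → par.uvCutoff ρ r = 1) ∧
    ((3 + par.η⁻¹) * (par.M : ℝ) ^ ρ ≤ r → par.uvCutoff ρ r = 0) := by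
  have hM : (0 : ℝ) < par.M := by linarith [par.one_lt_M]
  exact ⟨fun h => scaledCutoff_eq_one par.τ par.η hM ρ h,
    fun h => scaledCutoff_eq_zero par.τ par.hη hM ρ h⟩

end Parameters

/-! ## (K3)–(K4) The pinned carrier -/

/-- The finitary shape of the Slavnov left-hand side (K4): a constant plus finitely many
(coefficient, arity, test datum) triples. [cite: MagnenRivasseauSeneor1993, (VIII.6) p.378] -/
abbrev WardData : Type := ℝ × List (ℝ × (Σ n : ℕ, Fin n → Mode))

/-- Evaluation of a finitary Ward datum on a family of Schwinger functions:
`c₀ + Σ_k c_k · G n_k f_k`. [cite: MagnenRivasseauSeneor1993, (VIII.6) p.378 tl.20–21] -/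
def finitaryWard (G : (n : ℕ) → (Fin n → Mode) → ℝ) (d : WardData) : ℝ :=
  d.1 + (d.2.map fun t => t.1 * G t.2.1 t.2.2).sum

/-- MRS's main statement needs, and the print fixes, this much of the carrier (module docstring (K1)–(K5)): the
named parameters; for each ultraviolet index `ρ` the normalized expectation `⟨·⟩_{ax,ρ}` as a probability law on
configurations with finite moments (the bare measure (II.78) pushed to the axial field `A = T⁻¹(A′ − U)`, p.341
tl.25–26 — ASSUMED to be a probability law, which is part of the printed sketch); the axial gauge (II.7) as
vanishing of every moment with a time component; Ward test data with the finitary left-hand side of (VIII.6); the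
infrared correction `E_N`. [cite: MagnenRivasseauSeneor1993, p.327 tl.39–43, (II.78) p.347, (VIII.6) p.378] -/
structure PinnedTheory where
  /-- (K5) the named printed parameters -/
  par : Parameters
  /-- (K3) `⟨·⟩_{ax,ρ}` as a law on configurations -/
  law : ℕ → Measure Config
  isProb : ∀ ρ, IsProbabilityMeasure (law ρ)
  integrable : ∀ (ρ N : ℕ) (f : Fin N → Mode), Integrable (monomial f) (law ρ)
  /-- (K2) axial gauge `A₀ = 0`: moments with a time component vanish -/
  axial : ∀ (ρ N : ℕ) (f : Fin N → Mode), (∃ j, (f j).IsTime) → ∫ A, monomial f A ∂(law ρ) = 0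
  /-- test data of the `N`-source identity (VIII.6) -/
  WTest : ℕ → Type
  /-- (K4) the finitary left-hand side of (VIII.6) at each Ward test datum -/
  wardData : (N : ℕ) → WTest N → WardData
  /-- the infrared correction `E_N({x_j})` of (VIII.6) (no formula printed) -/
  E : (N : ℕ) → WTest N → ℝ

namespace PinnedTheory

variable (T : PinnedTheory)

/-- The cutoff-`ρ` Schwinger functions as MOMENTS: `S ρ N f = ∫ Π_j A(f j) d⟨·⟩_{ax,ρ}`.
[cite: MagnenRivasseauSeneor1993, (VIII.1) p.377 and p.378 tl.17–21] -/
def schwinger (ρ N : ℕ) (f : Fin N → Mode) : ℝ := ∫ A, monomial f A ∂(T.law ρ)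

/-- The underlying free carrier of `…MRS93MainStatement`. [cite: MagnenRivasseauSeneor1993, p.327 tl.39–43] -/
def toAxialTheory : AxialTheory where
  Test N := Fin N → Mode
  WTest := T.WTest
  S := T.schwinger
  wardLHS G N x := finitaryWard G (T.wardData N x)
  E := T.E

/-- **MRS's main statement (p.327 tl.39–43) over the pinned carrier** — by definition `MainStatementPrinted` of the
underlying carrier, now with the binders (K1)–(K5) named. Same status: a printed CLAIM with a self-declared sketch
of proof; a predicate, never a theorem. [cite: MagnenRivasseauSeneor1993, p.327 tl.39–43] -/
def PrintedStatement (T : PinnedTheory) : Prop := MainStatementPrinted T.toAxialTheory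

/-- Unfolding. [cite: MagnenRivasseauSeneor1993, p.327 tl.39–43] -/
theorem printedStatement_iff : T.PrintedStatement ↔
    UVLimitExistsPrinted T.toAxialTheory ∧ SlavnovPrinted T.toAxialTheory := Iff.rfl

/-- The carrier's Schwinger functions are the moments. [cite: MagnenRivasseauSeneor1993, (VIII.1) p.377] -/
@[simp] theorem toAxialTheory_S (ρ N : ℕ) (f : Fin N → Mode) :
    T.toAxialTheory.S ρ N f = T.schwinger ρ N f := rfl

/-- (K3) consequence: `⟨1⟩_{ax,ρ} = 1` — the empty moment is `1` for every `ρ`.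
[cite: MagnenRivasseauSeneor1993, p.378 tl.17 («normalized»)] -/
theorem schwinger_empty (ρ : ℕ) (f : Fin 0 → Mode) : T.schwinger ρ 0 f = 1 := by
  haveI := T.isProb ρ
  simp [schwinger, monomial]

/-- Hence the referee's all-zero carrier is NOT a pinned theory: no `PinnedTheory` has all Schwinger functions `0`.
[cite: MagnenRivasseauSeneor1993, p.378 tl.17] -/
theorem not_schwinger_all_zero : ¬ ∀ (ρ N : ℕ) (f : Fin N → Mode), T.schwinger ρ N f = 0 := by
  intro h
  have := h 0 0 Fin.elim0
  rw [schwinger_empty] at this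
  exact one_ne_zero this

/-- (K3) consequence: moments are symmetric under permutation of the test datum.
[cite: MagnenRivasseauSeneor1993, (VIII.1) p.377] -/
theorem schwinger_perm (ρ N : ℕ) (f : Fin N → Mode) (σ : Equiv.Perm (Fin N)) :
    T.schwinger ρ N (f ∘ σ) = T.schwinger ρ N f := by
  unfold schwinger monomial
  congr 1
  ext A
  exact Fintype.prod_equiv σ (fun j => A ((f ∘ σ) j)) (fun j => A (f j)) (fun j => rfl)

/-- (K3) consequence: `⟨(Ã-coordinate)²⟩_{ax,ρ} ≥ 0`. [cite: MagnenRivasseauSeneor1993, (VIII.1) p.377] -/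
theorem schwinger_sq_nonneg (ρ : ℕ) (m : Mode) : 0 ≤ T.schwinger ρ 2 ![m, m] := by
  unfold schwinger
  refine integral_nonneg fun A => ?_
  simp [monomial, Fin.prod_univ_two]
  exact mul_self_nonneg _

/-- (K2) consequence: Schwinger functions with a time component vanish (axial gauge).
[cite: MagnenRivasseauSeneor1993, (II.7) p.329 and (VIII.1) p.377] -/
theorem schwinger_time (ρ N : ℕ) (f : Fin N → Mode) (h : ∃ j, (f j).IsTime) : T.schwinger ρ N f = 0 :=
  T.axial ρ N f h

/-- (K4) consequence, the printed «by definition tends to» (p.378 tl.20–22) as a LEMMA: if every cutoff Schwinger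
function converges, the finitary Ward left-hand sides converge to the left-hand side of the limit functions.
[cite: MagnenRivasseauSeneor1993, p.378 tl.20–22] -/
theorem tendsto_finitaryWard {G : ℕ → (n : ℕ) → (Fin n → Mode) → ℝ} {Glim : (n : ℕ) → (Fin n → Mode) → ℝ}
    (h : ∀ n f, Tendsto (fun ρ => G ρ n f) atTop (𝓝 (Glim n f))) (d : WardData) :
    Tendsto (fun ρ => finitaryWard (G ρ) d) atTop (𝓝 (finitaryWard Glim d)) := by
  obtain ⟨c₀, l⟩ := d
  unfold finitaryWard
  refine tendsto_const_nhds.add ?_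
  induction l with
  | nil => simp only [List.map_nil, List.sum_nil]; exact tendsto_const_nhds
  | cons t l ih =>
    simp only [List.map_cons, List.sum_cons]
    exact ((h t.2.1 t.2.2).const_mul t.1).add ih

/-- `WardLimitPrinted` holds for every pinned theory whose ultraviolet limit exists — one hypothesis of
`mainStatementPrinted_of_sectVIII` discharged by the pinning. [cite: MagnenRivasseauSeneor1993, p.378 tl.20–22] -/
theorem wardLimit (huv : UVLimitExistsPrinted T.toAxialTheory) : WardLimitPrinted T.toAxialTheory := by
  intro N x
  exact tendsto_finitaryWard (fun n f => tendsto_Slim_of_uvLimitExists huv n f) (T.wardData N x)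

/-- The Sect. VIII reduction over the pinned carrier: ultraviolet limit + approximate identities with
`δ_N(ρ) → 0` ⟹ the main statement (the passage to the limit is now automatic).
[cite: MagnenRivasseauSeneor1993, p.378 tl.13–25] -/
theorem mainStatement_of_sectVIII (δ : (N : ℕ) → T.WTest N → ℕ → ℝ)
    (huv : UVLimitExistsPrinted T.toAxialTheory) (happrox : ApproximateSlavnovPrinted T.toAxialTheory δ)
    (hδ : ErrorTermVanishesPrinted T.toAxialTheory δ) : T.PrintedStatement :=
  mainStatementPrinted_of_sectVIII T.toAxialTheory δ huv happrox (T.wardLimit huv) hδ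

/-- The two-threshold reading over pinned theories: a construction `(η, C) ↦ PinnedTheory` whose parameters ARE
the given `η`, `C`. [cite: MagnenRivasseauSeneor1993, p.330 tl.21, p.331 tl.9–12] -/
def MainStatementEventually (𝒞 : ℝ → ℝ → PinnedTheory) : Prop :=
  (∀ η C, 0 < η → (𝒞 η C).par.η = η ∧ (𝒞 η C).par.C = C) ∧
    MainStatement.MainStatementEventually fun η C => (𝒞 η C).toAxialTheory

end PinnedTheory

/-! ## The vacuity frontier, exhibited -/

/-- The degenerate model that the pinning does NOT exclude: every `⟨·⟩_{ax,ρ}` the Dirac mass at the zero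
configuration (the field switched off), `E_N :=` the constant term of the Ward functional. Ours, for honesty —
see the module docstring. [cite: MagnenRivasseauSeneor1993, p.327 tl.39–43] -/
def diracModel (par : Parameters) (WTest : ℕ → Type) (wardData : (N : ℕ) → WTest N → WardData) :
    PinnedTheory where
  par := par
  law _ := Measure.dirac 0
  isProb _ := Measure.dirac.isProbabilityMeasure
  integrable _ _ f := integrable_dirac' (measurable_monomial f).stronglyMeasurable enorm_lt_top
  axial ρ N f h := by
    obtain ⟨j, _⟩ := h
    rw [integral_dirac' _ _ (measurable_monomial f).stronglyMeasurable]
    exact Finset.prod_eq_zero (Finset.mem_univ j) rfl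
  WTest := WTest
  wardData := wardData
  E N x := (wardData N x).1

/-- In the Dirac model every Schwinger function is the monomial at `0`: `1` if `N = 0`, else `0`.
[cite: MagnenRivasseauSeneor1993, p.327 tl.39–43] -/
theorem diracModel_schwinger (par : Parameters) (WTest : ℕ → Type)
    (wardData : (N : ℕ) → WTest N → WardData) (ρ N : ℕ) (f : Fin N → Mode) :
    (diracModel par WTest wardData).schwinger ρ N f = monomial f 0 := by
  unfold PinnedTheory.schwinger diracModel
  exact integral_dirac' _ _ (measurable_monomial f).stronglyMeasurable

/-- **The vacuity frontier.** The Dirac model satisfies the pinned main statement: constant sequences converge, and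
with `E_N` chosen as the constant term the identity (VIII.6) holds because every moment of positive degree
vanishes at the zero field. What is missing to exclude it is analytic (a printed normalisation of a moment of
(II.78); a printed formula for `E_N`) — not in print, hence not typed. [cite: MagnenRivasseauSeneor1993, p.327 tl.39–48] -/
theorem diracModel_mainStatement (par : Parameters) (WTest : ℕ → Type)
    (wardData : (N : ℕ) → WTest N → WardData)
    (hward : ∀ N x, ∀ t ∈ (wardData N x).2, 1 ≤ t.2.1) :
    (diracModel par WTest wardData).PrintedStatement := by
  set T := diracModel par WTest wardData with hT
  have hS : ∀ ρ N f, T.schwinger ρ N f = monomial f 0 := diracModel_schwinger par WTest wardData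
  have huv : UVLimitExistsPrinted T.toAxialTheory := by
    intro N f
    refine ⟨monomial f 0, ?_⟩
    simp only [PinnedTheory.toAxialTheory_S, hS]
    exact tendsto_const_nhds
  refine ⟨huv, ?_⟩
  intro N x
  -- the limit Schwinger functions are the constants `monomial f 0`
  have hlim : ∀ n f, T.toAxialTheory.Slim n f = monomial f 0 := by
    intro n f
    have h1 := tendsto_Slim_of_uvLimitExists huv n f
    have h2 : Tendsto (fun ρ => T.toAxialTheory.S ρ n f) atTop (𝓝 (monomial f 0)) := by
      simp only [PinnedTheory.toAxialTheory_S, hS]; exact tendsto_const_nhds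
    exact tendsto_nhds_unique h1 h2
  -- every listed term has positive degree, so its monomial vanishes at 0
  have hzero : ∀ t ∈ (wardData N x).2, t.1 * T.toAxialTheory.Slim t.2.1 t.2.2 = 0 := by
    rintro ⟨c, n, f⟩ ht
    rw [hlim]
    have hn : 1 ≤ n := hward N x _ ht
    have : monomial f (0 : Config) = 0 := by
      unfold monomial
      cases n with
      | zero => exact absurd hn (by norm_num)
      | succ k => exact Finset.prod_eq_zero (Finset.mem_univ 0) rfl
    rw [this, mul_zero]
  show finitaryWard T.toAxialTheory.Slim (wardData N x) = (wardData N x).1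
  unfold finitaryWard
  rw [List.sum_eq_zero, add_zero]
  intro v hv
  rw [List.mem_map] at hv
  obtain ⟨t, ht, rfl⟩ := hv
  exact hzero t ht

/-! ## (v1.1) The Prop interface on the free carrier — the shape asked for by the cell (lead ruling R6,
referee FIX «`AxialTheory.IsMRSTheory …`; restate the main statement over `(T) (hT : T.IsMRSTheory …)`») -/

/-- `T.IsMRSTheory par`: the free carrier `T` of `…MRS93MainStatement` IS the underlying carrier of a pinned theory
with the named printed parameters `par` — i.e. its test data are the momentum-lattice modes, its Schwinger
functions are the moments of probability laws `⟨·⟩_{ax,ρ}` obeying the axial gauge, its Slavnov left-hand side is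
finitary ((K1)–(K5) of the module docstring). Consumers take `(hT : T.IsMRSTheory par) (h : MainStatementPrinted T)`.
[cite: MagnenRivasseauSeneor1993, p.327 tl.39–43, p.328 tl.12–17, (II.7) p.329, p.378 tl.17–21] -/
def AxialTheory.IsMRSTheory (T : AxialTheory) (par : Parameters) : Prop :=
  ∃ P : PinnedTheory, P.par = par ∧ P.toAxialTheory = T

/-- Every pinned theory presents its carrier. [cite: MagnenRivasseauSeneor1993, p.327 tl.39–43] -/
theorem PinnedTheory.isMRSTheory (P : PinnedTheory) : P.toAxialTheory.IsMRSTheory P.par := ⟨P, rfl, rfl⟩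

/-- Over the interface the pinned statement and the printed predicate agree.
[cite: MagnenRivasseauSeneor1993, p.327 tl.39–43] -/
theorem PinnedTheory.printedStatement_iff_mainStatementPrinted (P : PinnedTheory) :
    P.PrintedStatement ↔ MainStatementPrinted P.toAxialTheory := Iff.rfl

/-- Over the interface, «by definition tends to» (p.378 tl.20–22) is automatic: `WardLimitPrinted` follows from the
existence of the ultraviolet limit. [cite: MagnenRivasseauSeneor1993, p.378 tl.20–22] -/
theorem wardLimit_of_isMRSTheory {T : AxialTheory} {par : Parameters} (hT : T.IsMRSTheory par)
    (huv : UVLimitExistsPrinted T) : WardLimitPrinted T := by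
  obtain ⟨P, -, rfl⟩ := hT
  exact P.wardLimit huv

/-- The Sect. VIII reduction over the interface (three hypotheses instead of four).
[cite: MagnenRivasseauSeneor1993, p.378 tl.13–25] -/
theorem mainStatementPrinted_of_isMRSTheory {T : AxialTheory} {par : Parameters} (hT : T.IsMRSTheory par)
    (δ : (N : ℕ) → T.WTest N → ℕ → ℝ) (huv : UVLimitExistsPrinted T)
    (happrox : ApproximateSlavnovPrinted T δ) (hδ : ErrorTermVanishesPrinted T δ) : MainStatementPrinted T :=
  mainStatementPrinted_of_sectVIII T δ huv happrox (wardLimit_of_isMRSTheory hT huv) hδ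

/-- No MRS theory in the sense of the interface has all Schwinger functions zero (`⟨1⟩_{ax,ρ} = 1`): the
all-zero carrier of the referee's probe is excluded. [cite: MagnenRivasseauSeneor1993, p.378 tl.17] -/
theorem IsMRSTheory.exists_schwinger_ne_zero {T : AxialTheory} {par : Parameters} (hT : T.IsMRSTheory par) :
    ∃ (N : ℕ) (f : T.Test N), T.S 0 N f ≠ 0 := by
  obtain ⟨P, -, rfl⟩ := hT
  refine ⟨0, Fin.elim0, ?_⟩
  rw [PinnedTheory.toAxialTheory_S, P.schwinger_empty]
  exact one_ne_zero

/-- … and the vacuity frontier carries over verbatim: the zero-field model presents an MRS theory in the sense of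
the interface for EVERY choice of the named parameters, and satisfies the printed predicate.
[cite: MagnenRivasseauSeneor1993, p.327 tl.39–48] -/
theorem exists_isMRSTheory_mainStatementPrinted (par : Parameters) :
    ∃ T : AxialTheory, T.IsMRSTheory par ∧ MainStatementPrinted T :=
  ⟨(diracModel par (fun _ => Unit) (fun _ _ => (0, []))).toAxialTheory,
    (diracModel par _ _).isMRSTheory,
    diracModel_mainStatement par _ _ (fun _ _ t ht => by simp at ht)⟩

end MainStatement

end Literature.MathematicalPhysics.QuantumFieldTheory.MagnenRivasseauSeneor1993
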